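import Literature.Analysis.Quadrature.TrapezoidalRulePeriodic
import Literature.Analysis.Toeplitz.OneSidedSeries
import HarnessLib

/-!
# Free-gas (`U = 0`) sector witness for TcThermcert1's K1 family — part 4: the two ANALYTIC inputs of the twist-insensitivity estimate

`Inputs.shiftedTrapezoidShift_holds : ShiftedTrapezoidShift` (a real grid offset `θ/N` moves the `N`-point periodic trapezoidal sum of a
strip-analytic `2π`-periodic function by at most `4NB/(e^{aN} − 1)`; from the tree's Trefethen–Weideman theorem
`Literature.Analysis.Quadrature.norm_trapezoidal_sub_integral_le`) and `Inputs.freeBandLogStrip_holds : FreeBandLogStrip` (the one-line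
logarithm `Log(1 + exp(s + iφ + 2β cos z + 2β cos p₂))` is `2π`-periodic, holomorphic and bounded on the strip `|Im z| < min 1 (π/(24β))`).
HONEST FRAMING: statements about the FREE (`U = 0`) twisted torus gas and about symmetric functions of explicit reals;
nothing here touches `U = 8`; superconductivity in the Hubbard model is NOT proved (or disproved) by any of this.
Provenance: landed form of the crux workfile `Cruxes/ThermalStiffnessCeilingU8b10_le_1o8/FreeGasArcSkeleton.lean` v4.1 (tree 80a90c42bbb7)
+ `FreeGasArcInputs.lean` (d3c3c585d14e), planner `hubbard-floor-idea-rescuer` g5, card `free-gas-arc-darroch` (crit-1 KEEP);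
hubbard-floor support target ST-K1-U0-1, `--supports stmt-Ventures-26381` (TcThermcert1 crux K1). Split into ≤ 400-line modules
`Theorems/TcThermcert1FreeGas*.lean`.
-/

noncomputable section

namespace Summit.Ventures.CertifiedManyBodySolver.Theorems.FreeGasArc.Inputs

open Finset Real MeasureTheory
open scoped BigOperators

/-! ## §A The shifted-grid trapezoid bound (the skeleton's `ShiftedTrapezoidShift`, verbatim) -/

/-- [skeleton §3, verbatim] For `v` `2π`-periodic, complex-differentiable on the open strip `|Im z| < a` and bounded
there by `B`, the `N`-point grid sum moves by at most `4 N B /(e^{aN} − 1)` under a real grid offset `θ/N`. -/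
def ShiftedTrapezoidShift : Prop :=
  ∀ (v : ℂ → ℂ) (a B : ℝ), 0 < a → 0 ≤ B →
    (∀ z : ℂ, v (z + 2 * π) = v z) →
    DifferentiableOn ℂ v {z : ℂ | |z.im| < a} →
    (∀ z : ℂ, |z.im| < a → ‖v z‖ ≤ B) →
    ∀ (N : ℕ), 0 < N → ∀ θ : ℝ,
      ‖(∑ j ∈ range N, v ((2 * π * (j : ℝ) + θ) / (N : ℝ) : ℝ)) -
          ∑ j ∈ range N, v ((2 * π * (j : ℝ)) / (N : ℝ) : ℝ)‖ ≤ 4 * N * B / (Real.exp (a * N) - 1)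

/-- **The arc input holds** (two applications of Trefethen–Weideman Thm 4.2 as formalised in
`Literature.Analysis.Quadrature.norm_trapezoidal_sub_integral_le`: the trapezoidal sums of `v` and of its real
translate `z ↦ v(z + θ/N)` are both within `4πB/(e^{aN} − 1)` of the common period integral). -/
theorem shiftedTrapezoidShift_holds : ShiftedTrapezoidShift := by
  intro v a B ha _hB hper hd hM N hN θ
  have hN0 : N ≠ 0 := hN.ne'
  have hNc : (N : ℂ) ≠ 0 := by exact_mod_cast hN0
  have hNr : (0 : ℝ) < N := by exact_mod_cast hN
  set T : ℝ := 2 * π with hT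
  have hTpos : 0 < T := Real.two_pi_pos
  set c : ℝ := θ / N with hc
  -- the real translate of `v`
  set w : ℂ → ℂ := fun z => v (z + (c : ℂ)) with hw
  have hper' : ∀ z : ℂ, v (z + (T : ℂ)) = v z := fun z => by
    rw [hT]; push_cast; exact hper z
  have hwper : ∀ z : ℂ, w (z + (T : ℂ)) = w z := by
    intro z
    simp only [hw]
    rw [add_right_comm]
    exact hper' _
  have hwd : DifferentiableOn ℂ w {z : ℂ | |z.im| < a} := by
    have h1 : DifferentiableOn ℂ (v ∘ fun z : ℂ => z + (c : ℂ)) {z : ℂ | |z.im| < a} := by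
      refine hd.comp (by fun_prop) ?_
      intro z hz
      simpa using hz
    simpa [hw, Function.comp_def] using h1
  have hwM : ∀ z : ℂ, |z.im| < a → ‖w z‖ ≤ B := by
    intro z hz
    simp only [hw]
    exact hM _ (by simpa using hz)
  have h1 := Literature.Analysis.Quadrature.norm_trapezoidal_sub_integral_le hTpos ha hd hper' hM hN0
  have h2 := Literature.Analysis.Quadrature.norm_trapezoidal_sub_integral_le hTpos ha hwd hwper hwM hN0
  -- the two period integrals agree (translation invariance of the period integral)
  have hint : ∫ x in (0:ℝ)..T, w x = ∫ x in (0:ℝ)..T, v x := by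
    have e1 : (∫ x in (0:ℝ)..T, w x) = ∫ x in (0:ℝ)..T, (fun y : ℝ => v y) (x + c) := by
      apply intervalIntegral.integral_congr
      intro x _
      simp only [hw]
      push_cast
      rfl
    rw [e1, intervalIntegral.integral_comp_add_right (fun y : ℝ => v y) c]
    have hp : Function.Periodic (fun y : ℝ => v y) T := by
      intro y
      show v ((y + T : ℝ) : ℂ) = v y
      push_cast
      exact hper' y
    have h3 := hp.intervalIntegral_add_eq c 0
    rw [zero_add] at h3
    rw [zero_add, show T + c = c + T by ring]
    exact h3
  -- subtract the two estimates
  have hden : 0 < Real.exp (a * N) - 1 := by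
    have : 1 < Real.exp (a * N) := Real.one_lt_exp_iff.mpr (by positivity)
    linarith
  have e1 : Real.exp (2 * π * a * N / T) = Real.exp (a * N) := by
    congr 1
    rw [hT]
    field_simp
  rw [e1] at h1 h2
  have hsub : ‖(T / N : ℂ) * (∑ k ∈ Finset.range N, w (k * T / N) - ∑ k ∈ Finset.range N, v (k * T / N))‖
      ≤ 2 * T * B / (Real.exp (a * N) - 1) + 2 * T * B / (Real.exp (a * N) - 1) := by
    have : (T / N : ℂ) * (∑ k ∈ Finset.range N, w (k * T / N) - ∑ k ∈ Finset.range N, v (k * T / N))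
        = ((T / N : ℂ) * ∑ k ∈ Finset.range N, w (k * T / N) - ∫ x in (0:ℝ)..T, w x)
          - ((T / N : ℂ) * ∑ k ∈ Finset.range N, v (k * T / N) - ∫ x in (0:ℝ)..T, v x) := by
      rw [hint]; ring
    rw [this]
    exact (norm_sub_le _ _).trans (add_le_add h2 h1)
  -- remove the factor `T/N`
  have hnormTN : ‖(T / N : ℂ)‖ = T / N := by
    rw [show (T / N : ℂ) = ((T / N : ℝ) : ℂ) by push_cast; rfl, Complex.norm_real]
    exact abs_of_pos (div_pos hTpos hNr)
  rw [norm_mul, hnormTN] at hsub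
  have hTN : 0 < T / N := div_pos hTpos hNr
  have hsub' : ‖∑ k ∈ Finset.range N, w (k * T / N) - ∑ k ∈ Finset.range N, v (k * T / N)‖
      ≤ 4 * N * B / (Real.exp (a * N) - 1) := by
    have h4 := (le_div_iff₀' hTN).mpr hsub
    refine h4.trans_eq ?_
    field_simp
    ring
  -- identify the nodes
  have hnode1 : ∑ k ∈ Finset.range N, w (k * T / N) = ∑ j ∈ range N, v ((2 * π * (j : ℝ) + θ) / (N : ℝ) : ℝ) := by
    refine Finset.sum_congr rfl fun k _ => ?_
    simp only [hw, hc, hT]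
    congr 1
    push_cast
    field_simp
  have hnode2 : ∑ k ∈ Finset.range N, v (k * T / N) = ∑ j ∈ range N, v ((2 * π * (j : ℝ)) / (N : ℝ) : ℝ) := by
    refine Finset.sum_congr rfl fun k _ => ?_
    simp only [hT]
    congr 1
    push_cast
    ring
  rw [hnode1, hnode2] at hsub'
  exact hsub'

/-! ## §H The one-line logarithm is strip-analytic (the skeleton v2's `FreeBandLogStrip`, verbatim) -/

/-- `|sinh y| ≤ 2|y|` for `|y| ≤ 1`. -/
theorem abs_sinh_le_two_mul_abs {y : ℝ} (hy : |y| ≤ 1) : |Real.sinh y| ≤ 2 * |y| := by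
  rw [Real.sinh_eq]
  have h1 := Real.abs_exp_sub_one_le hy
  have h2 := Real.abs_exp_sub_one_le (x := -y) (by rwa [abs_neg])
  rw [abs_neg] at h2
  have : Real.exp y - Real.exp (-y) = (Real.exp y - 1) - (Real.exp (-y) - 1) := by ring
  rw [this, abs_div, abs_two]
  calc |(Real.exp y - 1) - (Real.exp (-y) - 1)| / 2
      ≤ (|Real.exp y - 1| + |Real.exp (-y) - 1|) / 2 := by gcongr; exact abs_sub _ _
    _ ≤ (2 * |y| + 2 * |y|) / 2 := by gcongr
    _ = 2 * |y| := by ring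

/-- `cosh y ≤ 3` for `|y| ≤ 1`. -/
theorem cosh_le_three {y : ℝ} (hy : |y| ≤ 1) : Real.cosh y ≤ 3 := by
  rw [Real.cosh_eq]
  have h1 := (abs_le.1 (Real.abs_exp_sub_one_le hy)).2
  have h2 := (abs_le.1 (Real.abs_exp_sub_one_le (x := -y) (by rwa [abs_neg]))).2
  rw [abs_neg] at h2
  linarith

/-- [skeleton v2 §3, verbatim] For `β > 0` there are a strip half-width `a > 0` and a bound `B` such that for every
log-fugacity `s ∈ [−4β − 1, 4β + 1]`, every arc angle `|φ| ≤ π/2` and every transverse momentum `p₂`, the one-line logarithm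
`v(z) = Log(1 + exp(s + iφ + 2β cos z + 2β cos p₂))` is `2π`-periodic, complex-differentiable on `|Im z| < a`, bounded by
`B` there, and exponentiates back to the factor on the real line. -/
def FreeBandLogStrip : Prop :=
  ∀ β : ℝ, 0 < β → ∃ a : ℝ, 0 < a ∧ ∃ B : ℝ, 0 ≤ B ∧
    ∀ s : ℝ, -4 * β - 1 ≤ s → s ≤ 4 * β + 1 → ∀ φ : ℝ, |φ| ≤ π / 2 → ∀ p₂ : ℝ,
      let v : ℂ → ℂ := fun z =>
        Complex.log (1 + Complex.exp ((s : ℂ) + (φ : ℂ) * Complex.I + 2 * β * Complex.cos z + 2 * β * Real.cos p₂))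
      (∀ z : ℂ, v (z + 2 * π) = v z) ∧
      DifferentiableOn ℂ v {z : ℂ | |z.im| < a} ∧
      (∀ z : ℂ, |z.im| < a → ‖v z‖ ≤ B) ∧
      (∀ p₁ : ℝ, Complex.exp (v p₁) =
        1 + Complex.exp ((s : ℂ) + (φ : ℂ) * Complex.I + 2 * β * Real.cos p₁ + 2 * β * Real.cos p₂))

/-- **The strip input holds**, with `a = min 1 (π/(24β))` and `B = e^{12β+1} + 1 + π`: on the strip the exponent has
imaginary part in `[−2π/3, 2π/3]` (`|φ| ≤ π/2`, `|Im(2β cos z)| ≤ 4βa ≤ π/6`), so `w = e^{g}` has `Re w ≥ −‖w‖/2`,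
`1 + w` lies in the slit plane with `‖1 + w‖ ≥ 1/2`, and `‖w‖ ≤ e^{12β+1}`. -/
theorem freeBandLogStrip_holds : FreeBandLogStrip := by
  intro β hβ
  have ha_pos : 0 < min 1 (π / (24 * β)) := lt_min one_pos (by positivity)
  have ha1 : min 1 (π / (24 * β)) ≤ 1 := min_le_left _ _
  have ha2 : 4 * β * min 1 (π / (24 * β)) ≤ π / 6 := by
    calc 4 * β * min 1 (π / (24 * β)) ≤ 4 * β * (π / (24 * β)) := by gcongr; exact min_le_right _ _
      _ = π / 6 := by field_simp; ring
  refine ⟨min 1 (π / (24 * β)), ha_pos, Real.exp (12 * β + 1) + 1 + π, by positivity, ?_⟩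
  intro s hs1 hs2 φ hφ p₂
  dsimp only
  -- the exponent
  set g : ℂ → ℂ := fun z =>
    (s : ℂ) + (φ : ℂ) * Complex.I + 2 * β * Complex.cos z + 2 * β * Real.cos p₂ with hg
  have hgz : ∀ z : ℂ, (s : ℂ) + (φ : ℂ) * Complex.I + 2 * β * Complex.cos z + 2 * β * Real.cos p₂ = g z :=
    fun z => rfl
  simp_rw [hgz]
  -- real and imaginary parts of `cos z` (kept local: the tree has these as lemmas in unrelated modules)
  have cos_re_eq : ∀ z : ℂ, (Complex.cos z).re = Real.cos z.re * Real.cosh z.im := fun z => by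
    rw [Complex.cos_eq]; simp [Complex.cos_ofReal_re, Complex.cosh_ofReal_re]
  have cos_im_eq : ∀ z : ℂ, (Complex.cos z).im = -(Real.sin z.re * Real.sinh z.im) := fun z => by
    rw [Complex.cos_eq]; simp [Complex.sin_ofReal_re, Complex.sinh_ofReal_re]
  -- key facts on the strip
  have key : ∀ z : ℂ, |z.im| < min 1 (π / (24 * β)) →
      (1 + Complex.exp (g z)) ∈ Complex.slitPlane ∧ 1 / 2 ≤ ‖1 + Complex.exp (g z)‖ ∧
        ‖Complex.exp (g z)‖ ≤ Real.exp (12 * β + 1) := by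
    intro z hz
    have hy1 : |z.im| ≤ 1 := hz.le.trans ha1
    have hgim : (g z).im = φ - 2 * β * (Real.sin z.re * Real.sinh z.im) := by
      simp [hg, cos_im_eq]; ring
    have hgre : (g z).re = s + 2 * β * (Real.cos z.re * Real.cosh z.im) + 2 * β * Real.cos p₂ := by
      simp [hg, cos_re_eq]
    have hsinh : |Real.sinh z.im| ≤ 2 * |z.im| := abs_sinh_le_two_mul_abs hy1
    have hss : |Real.sin z.re * Real.sinh z.im| ≤ 2 * min 1 (π / (24 * β)) := by
      rw [abs_mul]
      calc |Real.sin z.re| * |Real.sinh z.im| ≤ 1 * (2 * |z.im|) := by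
            gcongr
            · exact Real.abs_sin_le_one _
        _ ≤ 2 * min 1 (π / (24 * β)) := by linarith [hz.le]
    have hψ : |(g z).im| ≤ π / 2 + π / 6 := by
      rw [hgim]
      have h2 : |2 * β * (Real.sin z.re * Real.sinh z.im)| ≤ 4 * β * min 1 (π / (24 * β)) := by
        rw [abs_mul, abs_of_pos (by positivity : (0:ℝ) < 2 * β)]
        nlinarith [hss, hβ]
      calc |φ - 2 * β * (Real.sin z.re * Real.sinh z.im)|
          ≤ |φ| + |2 * β * (Real.sin z.re * Real.sinh z.im)| := abs_sub _ _
        _ ≤ π / 2 + π / 6 := by linarith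
    have hcos : -(1 / 2 : ℝ) ≤ Real.cos (g z).im := by
      rw [← Real.cos_abs]
      have hle : |(g z).im| ≤ π / 6 + π / 2 := by linarith
      have := Real.cos_le_cos_of_nonneg_of_le_pi (abs_nonneg _) (by linarith [Real.pi_pos]) hle
      rw [Real.cos_add_pi_div_two, Real.sin_pi_div_six] at this
      linarith
    have hρpos : 0 < Real.exp (g z).re := Real.exp_pos _
    have hw_re : (Complex.exp (g z)).re = Real.exp (g z).re * Real.cos (g z).im := Complex.exp_re _
    have hw_im : (Complex.exp (g z)).im = Real.exp (g z).re * Real.sin (g z).im := Complex.exp_im _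
    have hw_norm : ‖Complex.exp (g z)‖ = Real.exp (g z).re := Complex.norm_exp _
    refine ⟨?_, ?_, ?_⟩
    · rw [Complex.mem_slitPlane_iff]
      by_cases hsin : Real.sin (g z).im = 0
      · left
        have hlt1 : -π < (g z).im := by have := (abs_le.1 hψ).1; linarith [Real.pi_pos]
        have hlt2 : (g z).im < π := by have := (abs_le.1 hψ).2; linarith [Real.pi_pos]
        have h0 : (g z).im = 0 := (Real.sin_eq_zero_iff_of_lt_of_lt hlt1 hlt2).1 hsin
        rw [Complex.add_re, Complex.one_re, hw_re, h0, Real.cos_zero, mul_one]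
        linarith
      · right
        rw [Complex.add_im, Complex.one_im, hw_im, zero_add]
        exact mul_ne_zero hρpos.ne' hsin
    · have hsq : (3 : ℝ) / 4 ≤ ‖1 + Complex.exp (g z)‖ ^ 2 := by
        rw [Complex.sq_norm, Complex.normSq_apply, Complex.add_re, Complex.add_im, Complex.one_re, Complex.one_im,
          hw_re, hw_im, zero_add]
        have hsc : Real.sin (g z).im ^ 2 + Real.cos (g z).im ^ 2 = 1 := Real.sin_sq_add_cos_sq _
        nlinarith [hcos, hρpos, hsc, sq_nonneg (Real.exp (g z).re - 1 / 2)]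
      nlinarith [norm_nonneg (1 + Complex.exp (g z)), hsq]
    · rw [hw_norm]
      apply Real.exp_le_exp.2
      rw [hgre]
      have hcosh : Real.cosh z.im ≤ 3 := cosh_le_three hy1
      have h1 : Real.cos z.re * Real.cosh z.im ≤ 3 := by
        calc Real.cos z.re * Real.cosh z.im ≤ |Real.cos z.re * Real.cosh z.im| := le_abs_self _
          _ = |Real.cos z.re| * Real.cosh z.im := by rw [abs_mul, abs_of_pos (Real.cosh_pos _)]
          _ ≤ 1 * 3 := by
              gcongr
              · exact Real.abs_cos_le_one _
          _ = 3 := one_mul _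
      have h2 : Real.cos p₂ ≤ 1 := Real.cos_le_one _
      nlinarith [hβ, h1, h2, hs2]
  refine ⟨?_, ?_, ?_, ?_⟩
  · -- periodicity
    intro z
    simp only [hg, Complex.cos_add_two_pi]
  · -- differentiability on the strip
    intro z hz
    have hz' : |z.im| < min 1 (π / (24 * β)) := hz
    apply DifferentiableAt.differentiableWithinAt
    have hd : DifferentiableAt ℂ (fun z => 1 + Complex.exp (g z)) z := by
      simp only [hg]
      fun_prop
    exact hd.clog (key z hz').1
  · -- the bound
    intro z hz
    obtain ⟨hslit, hlow, hup⟩ := key z hz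
    have hne : 1 + Complex.exp (g z) ≠ 0 := Complex.slitPlane_ne_zero hslit
    have hpos : 0 < ‖1 + Complex.exp (g z)‖ := norm_pos_iff.2 hne
    have hre : |(Complex.log (1 + Complex.exp (g z))).re| ≤ Real.exp (12 * β + 1) + 1 := by
      rw [Complex.log_re, abs_le]
      constructor
      · -- lower: log x = -log x⁻¹ ≥ -(x⁻¹ - 1) ≥ -1
        have hinv : Real.log (‖1 + Complex.exp (g z)‖)⁻¹ ≤ (‖1 + Complex.exp (g z)‖)⁻¹ - 1 :=
          Real.log_le_sub_one_of_pos (inv_pos.2 hpos)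
        rw [Real.log_inv] at hinv
        have hinv2 : (‖1 + Complex.exp (g z)‖)⁻¹ ≤ 2 := by
          rw [inv_le_comm₀ hpos (by norm_num)]; linarith
        linarith [Real.exp_pos (12 * β + 1)]
      · have h1 : Real.log ‖1 + Complex.exp (g z)‖ ≤ ‖1 + Complex.exp (g z)‖ - 1 := Real.log_le_sub_one_of_pos hpos
        have h2 : ‖1 + Complex.exp (g z)‖ ≤ 1 + ‖Complex.exp (g z)‖ := by
          calc ‖1 + Complex.exp (g z)‖ ≤ ‖(1 : ℂ)‖ + ‖Complex.exp (g z)‖ := norm_add_le _ _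
            _ = 1 + ‖Complex.exp (g z)‖ := by rw [norm_one]
        linarith
    have him : |(Complex.log (1 + Complex.exp (g z))).im| ≤ π := by
      rw [Complex.log_im]; exact Complex.abs_arg_le_pi _
    calc ‖Complex.log (1 + Complex.exp (g z))‖
        ≤ |(Complex.log (1 + Complex.exp (g z))).re| + |(Complex.log (1 + Complex.exp (g z))).im| :=
          Complex.norm_le_abs_re_add_abs_im _
      _ ≤ Real.exp (12 * β + 1) + 1 + π := by linarith
  · -- exponentiating back on the real line
    intro p₁
    have h0 : |((p₁ : ℂ)).im| < min 1 (π / (24 * β)) := by simpa using ha_pos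
    rw [Complex.exp_log (Complex.slitPlane_ne_zero (key p₁ h0).1)]
    simp only [hg, Complex.ofReal_cos]

end Summit.Ventures.CertifiedManyBodySolver.Theorems.FreeGasArc.Inputs

end
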